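import Literature.AlgebraicGeometry.ModuliOfAbelianVarieties.SiegelFineModuliScheme
import Literature.AlgebraicGeometry.AbelianSchemes.PolarizedLevelChange
import Literature.AlgebraicGeometry.ModuliOfAbelianVarieties.SiegelShimuraSetTransitionDegree
import HarnessLib

/-!
# The tower of Siegel fine moduli schemes along the principal levels
# ([Deligne1971TravauxShimura, 4.16–4.17], [MumfordFogartyKirwan1994, App. 7A]; cell hodgecm-mathlib, M1PRIME-DAG rung 0, W2 / W1b)

[MumfordFogartyKirwan1994, App. 7A (p. 235)] considers the fine moduli schemes «as a tower with respect to finite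
morphisms `𝒜_{nm} → 𝒜_n`»; [Deligne1971TravauxShimura, 4.16–4.17 (p. 150)] reads the family `(_{K(n)}M)_n` of
ℚ-schemes representing the moduli functors `F` at the principal levels `K(n)` as a projective system, 1.8 (p. 129)
«pour `K' ⊂ K` … l'application évidente».  For a FAMILY `𝓜 K` of fine moduli schemes indexed by the Siegel levels
(★ `SiegelFineModuliScheme g K.N δ`, [MumfordFogartyKirwan1994, Thm. 7.9] / [Deligne1971TravauxShimura, 4.16] as the
carrier (M)), the transition morphism along `f : K ⟶ K'` (`K ≤ K'`, `N(K') ∣ N(K)`, ★ `SiegelLevel.N_dvd_N_of_hom`) is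
the CLASSIFYING MORPHISM of the universal triple of `𝓜 K` with its level structure changed to `N(K')` (★
`PolarizedAbelianSchemeWithLevel.changeLevel`) — Yoneda by hand: the functor laws follow from the uniqueness in
`classify` (★ `classifyingMap_self`, `classifyingMap_comp`), the identity and transitivity of the level change and its
naturality for the pull-back relation.  This is the tower `Nm` of ★ `SiegelRationalModel` once the family comes from a
representability statement; nothing here is asserted, everything is constructed from the carrier.

## Main definitions and results
* `SiegelModuliTower.tr hg 𝓜 f` — the transition morphism `(𝓜 K).M ⟶ (𝓜 K').M` along `f : K ⟶ K'`.
* `SiegelModuliTower.tr_id`, `tr_comp` — the functor laws.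
* `SiegelModuliTower.tower hg 𝓜 : SiegelLevel δ ⥤ SchemeOver ℚ` — the tower as a functor.
* `SiegelModuliTower.tr_classifyingMap` — `tr` sends the classifying point of a triple over a test scheme to the
  classifying point of its level change (naturality; the input of `map_pts`).

Cell hodgecm-mathlib, #60 Mumford line, rung 0 (additive module downstream of (M)); B-plan1 P30 / W-layer W1b;
prover seat B-p09.  HC_CM is proved only modulo the 7 printed citations until rung 0 closes; this file discharges none.

## References
* [Deligne1971TravauxShimura] P. Deligne, *Travaux de Shimura*, Sém. Bourbaki 389 (1971), 1.8 (p. 129), Déf. 3.1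
  (p. 136), 4.16–4.17 (p. 150).
* [MumfordFogartyKirwan1994] Ch. 7 §2 Def. 7.3 (p. 129), §3 Thm. 7.9 (p. 139), App. 7A (pp. 235–236).
* [Milne2005ShimuraVarieties] J. S. Milne, *Introduction to Shimura varieties* (2005; 2017 revision), §5 p. 58 («`Sh_K → Sh_{K'}`»).
* Tree: ★ `SiegelFineModuliScheme` ((M): `classify`, `classifyingMap`, `classifyingMap_self`, `classifyingMap_comp`),
  ★ `PolarizedLevelChange`, ★ `SiegelShimuraSetTransitionDegree` (`SiegelLevel.N_dvd_N_of_hom`),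
  ★ `SiegelComplexRecordSystem` (`SiegelLevel`).
-/

open CategoryTheory CategoryTheory.Limits AlgebraicGeometry

noncomputable section

namespace Literature.AlgebraicGeometry.ModuliOfAbelianVarieties

open Literature.AlgebraicGeometry.Motives (SchemeOver)
open Literature.AlgebraicGeometry.AbelianSchemes (PolarizedAbelianSchemeWithLevel)

namespace SiegelModuliTower

variable {g : ℕ} {δ : Fin g → ℕ}

/-- `N(K) ≠ 0` for a Siegel level (`N ≥ 3`). [cite: Deligne1971TravauxShimura, Exemple 4.16 p. 150] -/
theorem N_ne_zero (K : SiegelLevel δ) : K.N ≠ 0 := by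
  have := K.three_le_N
  omega

/-- Along an arrow `f : K ⟶ K'` of Siegel levels, `N(K) = N(K') · (N(K)/N(K'))` (★ `SiegelLevel.N_dvd_N_of_hom`; needs
`0 < g`). [cite: Deligne1971TravauxShimura, 1.8 p. 129] -/
theorem N_eq_mul_div (hg : 0 < g) {K K' : SiegelLevel δ} (f : K ⟶ K') : K.N = K'.N * (K.N / K'.N) :=
  (Nat.mul_div_cancel' (SiegelLevel.N_dvd_N_of_hom hg f)).symm

/-- **The transition morphism `(𝓜 K).M → (𝓜 K').M` along `f : K ⟶ K'`** for a family of fine moduli schemes at the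
Siegel levels: the classifying morphism of the universal triple of `𝓜 K` with its level structure changed to `N(K')`
(Yoneda by hand for [MumfordFogartyKirwan1994, App. 7A]'s forget-level transformation).
[cite: MumfordFogartyKirwan1994, App. 7A (p. 235)] [cite: Deligne1971TravauxShimura, 4.16–4.17 p. 150] -/
def tr (hg : 0 < g) (𝓜 : ∀ K : SiegelLevel δ, SiegelFineModuliScheme g K.N δ) {K K' : SiegelLevel δ} (f : K ⟶ K') :
    (𝓜 K).M ⟶ (𝓜 K').M :=
  haveI := (𝓜 K).isLocallyNoetherian
  (𝓜 K').classifyingMap (𝓜 K).M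
    ((𝓜 K).univ.changeLevel K'.N (K.N / K'.N) (N_eq_mul_div hg f) (N_ne_zero K))

/-- `tr (𝟙 K) = 𝟙` (identity of the level change + `classifyingMap_self`). [cite: Deligne1971TravauxShimura, 1.8 p. 129] -/
theorem tr_id (hg : 0 < g) (𝓜 : ∀ K : SiegelLevel δ, SiegelFineModuliScheme g K.N δ) (K : SiegelLevel δ) :
    tr hg 𝓜 (𝟙 K) = 𝟙 (𝓜 K).M := by
  haveI := (𝓜 K).isLocallyNoetherian
  unfold tr
  rw [PolarizedAbelianSchemeWithLevel.changeLevel_self]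
  exact (𝓜 K).classifyingMap_self

/-- `tr (f ≫ f') = tr f ≫ tr f'` (transitivity + naturality of the level change, `classifyingMap_comp`).
[cite: Deligne1971TravauxShimura, 1.8 p. 129] -/
theorem tr_comp (hg : 0 < g) (𝓜 : ∀ K : SiegelLevel δ, SiegelFineModuliScheme g K.N δ) {K K' K'' : SiegelLevel δ}
    (f : K ⟶ K') (f' : K' ⟶ K'') : tr hg 𝓜 (f ≫ f') = tr hg 𝓜 f ≫ tr hg 𝓜 f' := by
  haveI := (𝓜 K).isLocallyNoetherian
  haveI := (𝓜 K').isLocallyNoetherian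
  obtain ⟨G, Ĝ, h⟩ := (𝓜 K').exists_isBaseChangeVia_classifyingMap (𝓜 K).M
    ((𝓜 K).univ.changeLevel K'.N (K.N / K'.N) (N_eq_mul_div hg f) (N_ne_zero K))
  have e := (𝓜 K'').classifyingMap_comp (tr hg 𝓜 f)
    ((𝓜 K').univ.changeLevel K''.N (K'.N / K''.N) (N_eq_mul_div hg f') (N_ne_zero K'))
    _ (h.changeLevel K''.N (K'.N / K''.N) (N_eq_mul_div hg f') (N_ne_zero K'))
  rw [PolarizedAbelianSchemeWithLevel.changeLevel_changeLevel _ _ _ _ _ _ _ _ _ (K.N / K''.N)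
    (N_eq_mul_div hg (f ≫ f'))] at e
  exact e.symm

/-- **The tower of a family of fine moduli schemes as a functor `SiegelLevel δ ⥤ SchemeOver ℚ`** — the `Nm` of ★
`SiegelRationalModel` for Mumford's model. [cite: Deligne1971TravauxShimura, Déf. 3.1 p. 136, 4.16–4.17 p. 150] -/
def tower (hg : 0 < g) (𝓜 : ∀ K : SiegelLevel δ, SiegelFineModuliScheme g K.N δ) : SiegelLevel δ ⥤ SchemeOver ℚ where
  obj K := (𝓜 K).M
  map f := tr hg 𝓜 f
  map_id K := tr_id hg 𝓜 K
  map_comp f f' := tr_comp hg 𝓜 f f'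

/-- **`tr` on classifying points**: for a triple `P'` of level `N(K)` over a locally noetherian test scheme `T`, the
composite of its classifying morphism with `tr f` is the classifying morphism of its level change `P'.changeLevel`
(naturality of the level change + `classifyingMap_comp`) — on `ℂ`-points this is «`[J, aK] ↦ [J, aK']`» once the
J1 dictionary reads classifying points as double cosets. [cite: Milne2005ShimuraVarieties, §5 p. 58] [cite: Deligne1971TravauxShimura, 1.8 p. 129] -/
theorem classifyingMap_comp_tr (hg : 0 < g) (𝓜 : ∀ K : SiegelLevel δ, SiegelFineModuliScheme g K.N δ)
    {K K' : SiegelLevel δ} (f : K ⟶ K') (T : SchemeOver ℚ) [IsLocallyNoetherian T.left]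
    (P' : PolarizedAbelianSchemeWithLevel g K.N δ T.left) :
    (𝓜 K).classifyingMap T P' ≫ tr hg 𝓜 f =
      (𝓜 K').classifyingMap T (P'.changeLevel K'.N (K.N / K'.N) (N_eq_mul_div hg f) (N_ne_zero K)) := by
  haveI := (𝓜 K).isLocallyNoetherian
  obtain ⟨G, Ĝ, h⟩ := (𝓜 K).exists_isBaseChangeVia_classifyingMap T P'
  exact (𝓜 K').classifyingMap_comp _ _ _ (h.changeLevel K'.N (K.N / K'.N) (N_eq_mul_div hg f) (N_ne_zero K))

end SiegelModuliTower

end Literature.AlgebraicGeometry.ModuliOfAbelianVarieties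

end
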